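import Literature.Topology.Immersions.HolonomicApproxWiggle
import Mathlib.Tactic.Module
import HarnessLib

/-!
# Holonomic approximation over a cube: the partial derivatives of the wiggled section

Topic `Literature/Topology/Immersions`; third file of the holonomic approximation engine
(Eliashberg–Mishachev 2002, Thm. 3.1.1–3.1.2) behind
`Literature.Topology.Immersions.Phillips1967_exists_isLocalDiffeomorph_of_isParallelizable`.
For the section `g = f₁ + Σᵢ ((u - Θᵢ) cᵢ + dᵢ)` of `HolonomicApproxWiggle.lean` we compute
`∂ⱼ g = dg(eⱼ)` in every coordinate direction:

* **normal directions** `l ≥ k` (`fderiv_g_apply_eV_of_isNormal`): all corrections depend on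
  the tangential coordinates only, so `∂_l g = ∂_l f + w_l + [l = k] Σᵢ cᵢ`;
* **tangential directions** `tⱼ` (`fderiv_g_apply_eV_tang`):
  `∂ⱼ g = ∂ⱼ f + Σ_{l ≥ k} z_l ∂ⱼ w_l + Σᵢ ((u - Θᵢ) ∂ⱼcᵢ + (-∂ⱼΘᵢ · cᵢ + ∂ⱼdᵢ))` with the two
  brackets in closed form (`fderiv_c_apply_eV_tang`, `key_combination`):
  `∂ⱼcᵢ = [i = j] (2/aᵢ) sin(Nᵢtᵢ) bᵢ - (2cos(Nᵢtᵢ)/(aᵢNᵢ)) ∂ⱼbᵢ` and — **the heart of the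
  construction** — `-∂ⱼΘᵢ · cᵢ + ∂ⱼdᵢ = [i = j] bᵢ + [j < i] (2aⱼNⱼ/(aᵢNᵢ)) cos(Nⱼtⱼ)cos(Nᵢtᵢ) bᵢ
  - (sin(2Nᵢtᵢ)/(2Nᵢ)) ∂ⱼbᵢ` (where `bᵢ ≠ 0` the cutoff `β` is `1` with vanishing derivative,
  and `2cos² - cos(2·) = 1`).

Everything is **proved**; no named facts.

## References

* Y. Eliashberg, N. Mishachev, *Introduction to the `h`-principle*, GSM 48 (2002), §§3.4–3.6.
  [EliashbergMishachev2002]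
-/

open scoped Topology ContDiff
open Set Function Filter Real

noncomputable section

namespace Literature.Topology.Immersions.HolonomicApprox

variable {n : ℕ} {G : Type*} [NormedAddCommGroup G] [NormedSpace ℝ G]

namespace Setup

variable (S : Setup n G)

/-! ### §0 Coordinates along tangential lines -/

/-- Auxiliary item `apply_tang_add_smul_eV_tang` of the explicit holonomic-approximation
construction. [cite: EliashbergMishachev2002, Thm. 3.1.2 (proof)] -/
theorem apply_tang_add_smul_eV_tang (z : EuclideanSpace ℝ (Fin n)) (s : ℝ) (i₀ m : Fin S.k) :
    (z + s • eV (S.tang i₀)) (S.tang m) = z (S.tang m) + if m = i₀ then s else 0 := by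
  by_cases h : m = i₀
  · subst h; simp
  · rw [if_neg h, add_zero]
    exact add_smul_eV_apply_of_ne _ _ fun h' => h (S.tang_injective h')

/-- Auxiliary item `apply_add_smul_eV_tang_of_isNormal` of the explicit holonomic-approximation
construction. [cite: EliashbergMishachev2002, Thm. 3.1.2 (proof)] -/
theorem apply_add_smul_eV_tang_of_isNormal (z : EuclideanSpace ℝ (Fin n)) (s : ℝ) (i₀ : Fin S.k)
    {l : Fin n} (hl : S.IsNormal l) : (z + s • eV (S.tang i₀)) l = z l :=
  add_smul_eV_apply_of_ne _ _ (S.ne_tang_of_isNormal hl i₀)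

/-- Auxiliary item `apply_κ_add_smul_eV_tang` of the explicit holonomic-approximation construction.
[cite: EliashbergMishachev2002, Thm. 3.1.2 (proof)] -/
theorem apply_κ_add_smul_eV_tang (z : EuclideanSpace ℝ (Fin n)) (s : ℝ) (i₀ : Fin S.k) :
    (z + s • eV (S.tang i₀)) S.κ = z S.κ :=
  S.apply_add_smul_eV_tang_of_isNormal z s i₀ S.isNormal_κ

/-- The derivative of `s ↦ F (t + [m = i₀] s)` at `0`. [folklore] -/
theorem hasDerivAt_comp_add_ite {F : ℝ → ℝ} {F' t : ℝ} (hF : HasDerivAt F F' t) (p : Prop)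
    [Decidable p] :
    HasDerivAt (fun s : ℝ => F (t + if p then s else 0)) (if p then F' else 0) 0 := by
  by_cases hp : p
  · simp only [hp, ↓reduceIte]
    have := HasDerivAt.comp_const_add t 0 (by rw [add_zero]; exact hF)
    exact this
  · simp only [hp, ↓reduceIte, add_zero]
    exact hasDerivAt_const 0 (F t)

/-! ### §1 Normal directions -/

/-- **`∂_l g` for a normal direction `l ≥ k`**: `∂_l g = ∂_l f + w_l + [l = k] Σᵢ cᵢ`. [folklore] -/
theorem fderiv_g_apply_eV_of_isNormal {S : Setup n G} (hf : ContDiff ℝ ∞ S.f) (hA : ContDiff ℝ ∞ S.A)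
    (z : EuclideanSpace ℝ (Fin n)) {l : Fin n} (hl : S.IsNormal l) :
    fderiv ℝ S.g z (eV l) = fderiv ℝ S.f z (eV l) + S.w l z +
      if l = S.κ then ∑ i : Fin S.k, S.c i z else 0 := by
  have hdiff : DifferentiableAt ℝ S.g z := (contDiff_g hf hA).differentiable (by simp) z
  refine fderiv_apply_eq_of_hasDerivAt hdiff ?_
  -- the section along the normal line
  have hline : (fun s : ℝ => S.g (z + s • eV l)) = fun s =>
      S.f (z + s • eV l) + (∑ l' ∈ Finset.univ.filter (fun l' : Fin n => S.IsNormal l'),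
        (z l' + if l' = l then s else 0) • S.w l' z) +
      ∑ i : Fin S.k, ((z S.κ + (if S.κ = l then s else 0) - S.Θ i z) • S.c i z + S.d i z) := by
    funext s
    simp only [g, f₁, S.w_add_smul_eV_of_isNormal _ z s hl, S.Θ_add_smul_eV_of_isNormal _ z s hl,
      S.c_add_smul_eV_of_isNormal _ z s hl, S.d_add_smul_eV_of_isNormal _ z s hl,
      add_smul_eV_apply z s l]
  rw [hline]
  -- differentiate
  have h1 : HasDerivAt (fun s : ℝ => S.f (z + s • eV l)) (fderiv ℝ S.f z (eV l)) 0 :=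
    hasDerivAt_comp_add_smul (hf.differentiable (by simp) z) _
  have h2 : HasDerivAt (fun s : ℝ => ∑ l' ∈ Finset.univ.filter (fun l' : Fin n => S.IsNormal l'),
      (z l' + if l' = l then s else 0) • S.w l' z) (S.w l z) 0 := by
    have : ∀ l' ∈ Finset.univ.filter (fun l' : Fin n => S.IsNormal l'),
        HasDerivAt (fun s : ℝ => (z l' + if l' = l then s else 0) • S.w l' z)
          ((if l' = l then (1 : ℝ) else 0) • S.w l' z) 0 := by
      intro l' _
      have hsc : HasDerivAt (fun s : ℝ => z l' + if l' = l then s else 0) (if l' = l then 1 else 0) 0 := by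
        have := hasDerivAt_comp_add_ite (F := id) (hasDerivAt_id (z l')) (l' = l)
        simpa using this
      exact hsc.smul_const _
    have hsum := HasDerivAt.fun_sum this
    have hval : (∑ l' ∈ Finset.univ.filter (fun l' : Fin n => S.IsNormal l'),
        (if l' = l then (1 : ℝ) else 0) • S.w l' z) = S.w l z := by
      rw [Finset.sum_eq_single l]
      · simp
      · intro l' _ h; simp [h]
      · intro h; exact absurd (Finset.mem_filter.2 ⟨Finset.mem_univ l, hl⟩) h
    rw [hval] at hsum
    exact hsum
  have h3 : HasDerivAt (fun s : ℝ => ∑ i : Fin S.k,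
      ((z S.κ + (if S.κ = l then s else 0) - S.Θ i z) • S.c i z + S.d i z))
      (if l = S.κ then ∑ i : Fin S.k, S.c i z else 0) 0 := by
    have : ∀ i ∈ (Finset.univ : Finset (Fin S.k)),
        HasDerivAt (fun s : ℝ => (z S.κ + (if S.κ = l then s else 0) - S.Θ i z) • S.c i z + S.d i z)
          ((if S.κ = l then (1 : ℝ) else 0) • S.c i z) 0 := by
      intro i _
      have hsc : HasDerivAt (fun s : ℝ => z S.κ + (if S.κ = l then s else 0) - S.Θ i z)
          (if S.κ = l then 1 else 0) 0 := by
        have := (hasDerivAt_comp_add_ite (F := id) (hasDerivAt_id (z S.κ)) (S.κ = l)).sub_const (S.Θ i z)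
        simpa using this
      simpa using (hsc.smul_const (S.c i z)).add_const (S.d i z)
    have hsum := HasDerivAt.fun_sum this
    have hval : (∑ i : Fin S.k, (if S.κ = l then (1 : ℝ) else 0) • S.c i z) =
        if l = S.κ then ∑ i : Fin S.k, S.c i z else 0 := by
      by_cases h : l = S.κ
      · subst h; simp
      · simp [h, Ne.symm h]
    rw [hval] at hsum
    exact hsum
  exact (h1.add h2).add h3

/-! ### §2 Tangential directions: the pieces along a tangential line -/

section Tangential

variable {S}
variable (hf : ContDiff ℝ ∞ S.f) (hA : ContDiff ℝ ∞ S.A)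
include hf hA

omit hf hA in
/-- `θ_l` along the tangential line in direction `t_{i₀}`. [folklore] -/
theorem hasDerivAt_θ_line (l i₀ : Fin S.k) (z : EuclideanSpace ℝ (Fin n)) :
    HasDerivAt (fun s : ℝ => S.θ l (z + s • eV (S.tang i₀)))
      (S.a l * (fderiv ℝ S.β z (eV (S.tang i₀)) * Real.sin (S.N l * z (S.tang l)) +
        S.β z * (if l = i₀ then S.N l * Real.cos (S.N l * z (S.tang l)) else 0))) 0 := by
  have hβ : HasDerivAt (fun s : ℝ => S.β (z + s • eV (S.tang i₀))) (fderiv ℝ S.β z (eV (S.tang i₀))) 0 :=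
    hasDerivAt_comp_add_smul (S.contDiff_β.differentiable (by simp) z) _
  have hsin : HasDerivAt (fun s : ℝ => Real.sin (S.N l * (z (S.tang l) + if l = i₀ then s else 0)))
      (if l = i₀ then S.N l * Real.cos (S.N l * z (S.tang l)) else 0) 0 := by
    have h1 : HasDerivAt (fun x : ℝ => Real.sin (S.N l * x)) (S.N l * Real.cos (S.N l * z (S.tang l)))
        (z (S.tang l)) :=
      (((hasDerivAt_id (z (S.tang l))).const_mul (S.N l)).sin).congr_deriv (by simp; ring)
    exact hasDerivAt_comp_add_ite h1 (l = i₀)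
  have h := (hβ.mul hsin).const_mul (S.a l)
  have heq : (fun s : ℝ => S.θ l (z + s • eV (S.tang i₀))) = fun s =>
      S.a l * (S.β (z + s • eV (S.tang i₀)) *
        Real.sin (S.N l * (z (S.tang l) + if l = i₀ then s else 0))) := by
    funext s; simp only [θ, S.apply_tang_add_smul_eV_tang z s i₀ l, mul_assoc]
  rw [heq]
  refine h.congr_deriv ?_
  simp only [zero_smul, add_zero, ite_self]

omit hf hA in
/-- `Θᵢ` along the tangential line in direction `t_{i₀}`. [folklore] -/
theorem hasDerivAt_Θ_line (i i₀ : Fin S.k) (z : EuclideanSpace ℝ (Fin n)) :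
    HasDerivAt (fun s : ℝ => S.Θ i (z + s • eV (S.tang i₀)))
      (∑ l ∈ Finset.univ.filter (fun l : Fin S.k => l ≤ i),
        S.a l * (fderiv ℝ S.β z (eV (S.tang i₀)) * Real.sin (S.N l * z (S.tang l)) +
          S.β z * (if l = i₀ then S.N l * Real.cos (S.N l * z (S.tang l)) else 0))) 0 := by
  have h := HasDerivAt.fun_sum fun l (_ : l ∈ Finset.univ.filter (fun l : Fin S.k => l ≤ i)) =>
    S.hasDerivAt_θ_line l i₀ z
  have heq : (fun s : ℝ => S.Θ i (z + s • eV (S.tang i₀))) =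
      fun s => ∑ l ∈ Finset.univ.filter (fun l : Fin S.k => l ≤ i), S.θ l (z + s • eV (S.tang i₀)) := by
    funext s; rfl
  rw [heq]; exact h

/-- `bᵢ` along the tangential line (abstract partial). [folklore] -/
theorem hasDerivAt_b_line (i i₀ : Fin S.k) (z : EuclideanSpace ℝ (Fin n)) :
    HasDerivAt (fun s : ℝ => S.b i (z + s • eV (S.tang i₀))) (fderiv ℝ (S.b i) z (eV (S.tang i₀))) 0 :=
  hasDerivAt_comp_add_smul ((contDiff_b hf hA i).differentiable (by simp) z) _

/-- `cᵢ` along the tangential line in direction `t_{i₀}`: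
`∂cᵢ = [i = i₀] (2/aᵢ) sin(Nᵢtᵢ) bᵢ - (2cos(Nᵢtᵢ)/(aᵢNᵢ)) ∂bᵢ`. [folklore] -/
theorem hasDerivAt_c_line (hN : ∀ i, S.N i ≠ 0) (ha : ∀ i, S.a i ≠ 0) (i i₀ : Fin S.k) (z : EuclideanSpace ℝ (Fin n)) :
    HasDerivAt (fun s : ℝ => S.c i (z + s • eV (S.tang i₀)))
      ((if i = i₀ then 2 / S.a i * Real.sin (S.N i * z (S.tang i)) else 0) • S.b i z +
        (-(2 / (S.a i * S.N i)) * Real.cos (S.N i * z (S.tang i))) •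
          fderiv ℝ (S.b i) z (eV (S.tang i₀))) 0 := by
  have hcos : HasDerivAt (fun s : ℝ => -(2 / (S.a i * S.N i)) *
      Real.cos (S.N i * (z (S.tang i) + if i = i₀ then s else 0)))
      (-(2 / (S.a i * S.N i)) * (if i = i₀ then -(S.N i * Real.sin (S.N i * z (S.tang i))) else 0)) 0 := by
    have h1 : HasDerivAt (fun x : ℝ => Real.cos (S.N i * x)) (-(S.N i * Real.sin (S.N i * z (S.tang i))))
        (z (S.tang i)) :=
      (((hasDerivAt_id (z (S.tang i))).const_mul (S.N i)).cos).congr_deriv (by simp; ring)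
    exact (hasDerivAt_comp_add_ite h1 (i = i₀)).const_mul _
  have h := hcos.smul (S.hasDerivAt_b_line hf hA i i₀ z)
  have heq : (fun s : ℝ => S.c i (z + s • eV (S.tang i₀))) =
      ((fun s : ℝ => -(2 / (S.a i * S.N i)) * Real.cos (S.N i * (z (S.tang i) + if i = i₀ then s else 0))) •
        fun s : ℝ => S.b i (z + s • eV (S.tang i₀))) := by
    funext s; simp only [c, Pi.smul_apply', S.apply_tang_add_smul_eV_tang z s i₀ i]
  rw [heq]
  refine h.congr_deriv ?_
  simp only [zero_smul, add_zero, ite_self]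
  by_cases hi : i = i₀
  · subst hi
    simp only [↓reduceIte]
    have hN' := hN i
    have ha' := ha i
    match_scalars <;> field_simp
  · simp only [hi, ↓reduceIte, mul_zero, zero_smul, add_zero, zero_add]

/-- `dᵢ` along the tangential line in direction `t_{i₀}`:
`∂dᵢ = -[i = i₀] cos(2Nᵢtᵢ) bᵢ - (sin(2Nᵢtᵢ)/(2Nᵢ)) ∂bᵢ`. [folklore] -/
theorem hasDerivAt_d_line (hN : ∀ i, S.N i ≠ 0) (i i₀ : Fin S.k) (z : EuclideanSpace ℝ (Fin n)) :
    HasDerivAt (fun s : ℝ => S.d i (z + s • eV (S.tang i₀)))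
      ((if i = i₀ then -Real.cos (2 * S.N i * z (S.tang i)) else 0) • S.b i z +
        (-(1 / (2 * S.N i)) * Real.sin (2 * S.N i * z (S.tang i))) •
          fderiv ℝ (S.b i) z (eV (S.tang i₀))) 0 := by
  have hsin : HasDerivAt (fun s : ℝ => -(1 / (2 * S.N i)) *
      Real.sin (2 * S.N i * (z (S.tang i) + if i = i₀ then s else 0)))
      (-(1 / (2 * S.N i)) * (if i = i₀ then 2 * S.N i * Real.cos (2 * S.N i * z (S.tang i)) else 0)) 0 := by
    have h1 : HasDerivAt (fun x : ℝ => Real.sin (2 * S.N i * x)) (2 * S.N i * Real.cos (2 * S.N i * z (S.tang i)))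
        (z (S.tang i)) :=
      (((hasDerivAt_id (z (S.tang i))).const_mul (2 * S.N i)).sin).congr_deriv (by simp; ring)
    exact (hasDerivAt_comp_add_ite h1 (i = i₀)).const_mul _
  have h := hsin.smul (S.hasDerivAt_b_line hf hA i i₀ z)
  have heq : (fun s : ℝ => S.d i (z + s • eV (S.tang i₀))) =
      ((fun s : ℝ => -(1 / (2 * S.N i)) * Real.sin (2 * S.N i * (z (S.tang i) + if i = i₀ then s else 0))) •
        fun s : ℝ => S.b i (z + s • eV (S.tang i₀))) := by
    funext s; simp only [d, Pi.smul_apply', S.apply_tang_add_smul_eV_tang z s i₀ i]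
  rw [heq]
  refine h.congr_deriv ?_
  simp only [zero_smul, add_zero, ite_self]
  by_cases hi : i = i₀
  · subst hi
    simp only [↓reduceIte]
    have hN' := hN i
    match_scalars <;> field_simp
  · simp only [hi, ↓reduceIte, mul_zero, zero_smul, add_zero, zero_add]

/-- `f₁` along the tangential line: `∂f₁ = ∂f + Σ_{l ≥ k} z_l ∂w_l`. [folklore] -/
theorem hasDerivAt_f₁_line (i₀ : Fin S.k) (z : EuclideanSpace ℝ (Fin n)) :
    HasDerivAt (fun s : ℝ => S.f₁ (z + s • eV (S.tang i₀)))
      (fderiv ℝ S.f z (eV (S.tang i₀)) +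
        ∑ l ∈ Finset.univ.filter (fun l : Fin n => S.IsNormal l),
          z l • fderiv ℝ (S.w l) z (eV (S.tang i₀))) 0 := by
  have h1 : HasDerivAt (fun s : ℝ => S.f (z + s • eV (S.tang i₀))) (fderiv ℝ S.f z (eV (S.tang i₀))) 0 :=
    hasDerivAt_comp_add_smul (hf.differentiable (by simp) z) _
  have h2 : ∀ l ∈ Finset.univ.filter (fun l : Fin n => S.IsNormal l),
      HasDerivAt (fun s : ℝ => (z + s • eV (S.tang i₀)) l • S.w l (z + s • eV (S.tang i₀)))
        (z l • fderiv ℝ (S.w l) z (eV (S.tang i₀))) 0 := by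
    intro l hl
    have hl' : S.IsNormal l := (Finset.mem_filter.1 hl).2
    have hw : HasDerivAt (fun s : ℝ => S.w l (z + s • eV (S.tang i₀))) (fderiv ℝ (S.w l) z (eV (S.tang i₀))) 0 :=
      hasDerivAt_comp_add_smul ((contDiff_w hf hA l).differentiable (by simp) z) _
    have h3 : HasDerivAt (fun s : ℝ => z l • S.w l (z + s • eV (S.tang i₀)))
        (z l • fderiv ℝ (S.w l) z (eV (S.tang i₀))) 0 := hw.const_smul (z l)
    refine h3.congr_of_eventuallyEq (Filter.Eventually.of_forall fun s => ?_)
    simp only [S.apply_add_smul_eV_tang_of_isNormal z s i₀ hl']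
  have h := h1.add (HasDerivAt.fun_sum h2)
  have heq : (fun s : ℝ => S.f₁ (z + s • eV (S.tang i₀))) = fun s =>
      S.f (z + s • eV (S.tang i₀)) + ∑ l ∈ Finset.univ.filter (fun l : Fin n => S.IsNormal l),
        (z + s • eV (S.tang i₀)) l • S.w l (z + s • eV (S.tang i₀)) := by
    funext s; rfl
  rw [heq]; exact h

/-- **`∂ⱼ g` for a tangential direction `tⱼ`, raw form**:
`∂ⱼ g = ∂ⱼ f + Σ_{l ≥ k} z_l ∂ⱼw_l + Σᵢ ((u - Θᵢ) ∂ⱼcᵢ - ∂ⱼΘᵢ · cᵢ + ∂ⱼdᵢ)` with the partials of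
`Θᵢ, cᵢ, dᵢ` as computed above. [folklore] -/
theorem fderiv_g_apply_eV_tang (hN : ∀ i, S.N i ≠ 0) (ha : ∀ i, S.a i ≠ 0) (i₀ : Fin S.k) (z : EuclideanSpace ℝ (Fin n)) :
    fderiv ℝ S.g z (eV (S.tang i₀)) =
      (fderiv ℝ S.f z (eV (S.tang i₀)) +
        ∑ l ∈ Finset.univ.filter (fun l : Fin n => S.IsNormal l), z l • fderiv ℝ (S.w l) z (eV (S.tang i₀))) +
      ∑ i : Fin S.k,
        ((z S.κ - S.Θ i z) •
            ((if i = i₀ then 2 / S.a i * Real.sin (S.N i * z (S.tang i)) else 0) • S.b i z +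
              (-(2 / (S.a i * S.N i)) * Real.cos (S.N i * z (S.tang i))) • fderiv ℝ (S.b i) z (eV (S.tang i₀))) -
          (∑ l ∈ Finset.univ.filter (fun l : Fin S.k => l ≤ i),
            S.a l * (fderiv ℝ S.β z (eV (S.tang i₀)) * Real.sin (S.N l * z (S.tang l)) +
              S.β z * (if l = i₀ then S.N l * Real.cos (S.N l * z (S.tang l)) else 0))) • S.c i z +
          ((if i = i₀ then -Real.cos (2 * S.N i * z (S.tang i)) else 0) • S.b i z +
            (-(1 / (2 * S.N i)) * Real.sin (2 * S.N i * z (S.tang i))) • fderiv ℝ (S.b i) z (eV (S.tang i₀)))) := by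
  have hdiff : DifferentiableAt ℝ S.g z := (contDiff_g hf hA).differentiable (by simp) z
  refine fderiv_apply_eq_of_hasDerivAt hdiff ?_
  have hterm : ∀ i ∈ (Finset.univ : Finset (Fin S.k)),
      HasDerivAt (fun s : ℝ => ((z + s • eV (S.tang i₀)) S.κ - S.Θ i (z + s • eV (S.tang i₀))) •
          S.c i (z + s • eV (S.tang i₀)) + S.d i (z + s • eV (S.tang i₀)))
        ((z S.κ - S.Θ i z) •
            ((if i = i₀ then 2 / S.a i * Real.sin (S.N i * z (S.tang i)) else 0) • S.b i z +
              (-(2 / (S.a i * S.N i)) * Real.cos (S.N i * z (S.tang i))) • fderiv ℝ (S.b i) z (eV (S.tang i₀))) -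
          (∑ l ∈ Finset.univ.filter (fun l : Fin S.k => l ≤ i),
            S.a l * (fderiv ℝ S.β z (eV (S.tang i₀)) * Real.sin (S.N l * z (S.tang l)) +
              S.β z * (if l = i₀ then S.N l * Real.cos (S.N l * z (S.tang l)) else 0))) • S.c i z +
          ((if i = i₀ then -Real.cos (2 * S.N i * z (S.tang i)) else 0) • S.b i z +
            (-(1 / (2 * S.N i)) * Real.sin (2 * S.N i * z (S.tang i))) • fderiv ℝ (S.b i) z (eV (S.tang i₀)))) 0 := by
    intro i _
    have hu : HasDerivAt (fun s : ℝ => (z + s • eV (S.tang i₀)) S.κ - S.Θ i (z + s • eV (S.tang i₀)))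
        (0 - ∑ l ∈ Finset.univ.filter (fun l : Fin S.k => l ≤ i),
          S.a l * (fderiv ℝ S.β z (eV (S.tang i₀)) * Real.sin (S.N l * z (S.tang l)) +
            S.β z * (if l = i₀ then S.N l * Real.cos (S.N l * z (S.tang l)) else 0))) 0 := by
      have hκ : HasDerivAt (fun s : ℝ => (z + s • eV (S.tang i₀)) S.κ) 0 0 := by
        have : (fun s : ℝ => (z + s • eV (S.tang i₀)) S.κ) = fun _ => z S.κ :=
          funext fun s => S.apply_κ_add_smul_eV_tang z s i₀
        rw [this]; exact hasDerivAt_const 0 _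
      exact hκ.sub (S.hasDerivAt_Θ_line i i₀ z)
    have h := (hu.smul (S.hasDerivAt_c_line hf hA hN ha i i₀ z)).add (S.hasDerivAt_d_line hf hA hN i i₀ z)
    refine h.congr_deriv ?_
    simp only [zero_smul, add_zero, zero_sub, neg_smul]
    abel
  have h := (S.hasDerivAt_f₁_line hf hA i₀ z).add (HasDerivAt.fun_sum hterm)
  have heq : (fun s : ℝ => S.g (z + s • eV (S.tang i₀))) = fun s =>
      S.f₁ (z + s • eV (S.tang i₀)) + ∑ i : Fin S.k,
        (((z + s • eV (S.tang i₀)) S.κ - S.Θ i (z + s • eV (S.tang i₀))) • S.c i (z + s • eV (S.tang i₀)) +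
          S.d i (z + s • eV (S.tang i₀))) := by
    funext s; rfl
  rw [heq]; exact h

end Tangential

/-! ### §3 The key combination `-∂ⱼΘᵢ · cᵢ + ∂ⱼdᵢ` -/

section Key

variable {S}

/-- Where `bᵢ z ≠ 0`, the raw partial of `Θᵢ` collapses: `β = 1`, `dβ = 0`, so
`∂ⱼΘᵢ = [j ≤ i] aⱼNⱼ cos(Nⱼtⱼ)`. [folklore] -/
theorem dΘ_raw_eq_of_b_ne_zero (hH : Holonomic S) {i i₀ : Fin S.k} {z : EuclideanSpace ℝ (Fin n)}
    {i' : Fin S.k} (hb : S.b i' z ≠ 0) :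
    (∑ l ∈ Finset.univ.filter (fun l : Fin S.k => l ≤ i),
        S.a l * (fderiv ℝ S.β z (eV (S.tang i₀)) * Real.sin (S.N l * z (S.tang l)) +
          S.β z * (if l = i₀ then S.N l * Real.cos (S.N l * z (S.tang l)) else 0))) =
      if i₀ ≤ i then S.a i₀ * (S.N i₀ * Real.cos (S.N i₀ * z (S.tang i₀))) else 0 := by
  have h0 : fderiv ℝ S.β z (eV (S.tang i₀)) = 0 := by
    rw [fderiv_β_eq_zero_of_b_ne_zero hH hb]; rfl
  rw [h0, β_eq_one_of_b_ne_zero hH hb]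
  simp only [zero_mul, zero_add, one_mul, mul_ite, mul_zero]
  rw [Finset.sum_ite_eq' (Finset.univ.filter (fun l : Fin S.k => l ≤ i)) i₀]
  simp [Finset.mem_filter]

/-- **The heart of the construction.** For all `z`:
`-∂ⱼΘᵢ · cᵢ + ∂ⱼdᵢ = [i = j] bᵢ + [j < i] (2aⱼNⱼ/(aᵢNᵢ)) cos(Nⱼtⱼ) cos(Nᵢtᵢ) bᵢ - (sin(2Nᵢtᵢ)/(2Nᵢ)) ∂ⱼbᵢ`
(with the raw expressions of `fderiv_g_apply_eV_tang`; `2cos² - cos(2·) = 1`). [folklore] -/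
theorem key_combination (hH : Holonomic S) (hN : ∀ i, S.N i ≠ 0) (ha : ∀ i, S.a i ≠ 0)
    (i i₀ : Fin S.k) (z : EuclideanSpace ℝ (Fin n)) :
    -((∑ l ∈ Finset.univ.filter (fun l : Fin S.k => l ≤ i),
        S.a l * (fderiv ℝ S.β z (eV (S.tang i₀)) * Real.sin (S.N l * z (S.tang l)) +
          S.β z * (if l = i₀ then S.N l * Real.cos (S.N l * z (S.tang l)) else 0))) • S.c i z) +
      ((if i = i₀ then -Real.cos (2 * S.N i * z (S.tang i)) else 0) • S.b i z +
        (-(1 / (2 * S.N i)) * Real.sin (2 * S.N i * z (S.tang i))) • fderiv ℝ (S.b i) z (eV (S.tang i₀))) =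
    (if i = i₀ then (1 : ℝ) else 0) • S.b i z +
      (if i₀ < i then 2 * (S.a i₀ * S.N i₀) / (S.a i * S.N i) *
          Real.cos (S.N i₀ * z (S.tang i₀)) * Real.cos (S.N i * z (S.tang i)) else 0) • S.b i z +
      (-(Real.sin (2 * S.N i * z (S.tang i)) / (2 * S.N i))) • fderiv ℝ (S.b i) z (eV (S.tang i₀)) := by
  by_cases hb : S.b i z = 0
  · -- all `bᵢ z` terms vanish, `cᵢ z = 0`
    simp only [hb, smul_zero, c_eq_zero_of_b_eq_zero i hb, neg_zero, zero_add, add_zero]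
    congr 1; ring
  · rw [dΘ_raw_eq_of_b_ne_zero hH (i := i) (i₀ := i₀) hb]
    simp only [c, smul_smul]
    have hN' := hN i
    have ha' := ha i
    by_cases hi : i = i₀
    · subst hi
      simp only [↓reduceIte, le_refl, lt_irrefl]
      have hcos : Real.cos (2 * S.N i * z (S.tang i)) = 2 * Real.cos (S.N i * z (S.tang i)) ^ 2 - 1 := by
        rw [show 2 * S.N i * z (S.tang i) = 2 * (S.N i * z (S.tang i)) by ring, Real.cos_two_mul]
      rw [hcos]
      match_scalars
      · field_simp; ring
      · field_simp
    · by_cases hlt : i₀ < i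
      · have hle : i₀ ≤ i := hlt.le
        simp only [hi, ↓reduceIte, hle, hlt]
        match_scalars
        · field_simp; ring
        · field_simp
      · have hnle : ¬ i₀ ≤ i := fun h => hlt (lt_of_le_of_ne h (Ne.symm hi))
        simp only [hi, ↓reduceIte, hnle, hlt, neg_zero, zero_mul, zero_smul, zero_add, neg_zero]
        match_scalars
        · ring

/-- `∂ⱼcᵢ` in closed form is already how `fderiv_g_apply_eV_tang` states it; here is the
**tangential identity in final form**:
`∂ⱼ g = ∂ⱼ f + Σ_{l ≥ k} z_l ∂ⱼw_l + Σᵢ ((u - Θᵢ) ∂ⱼcᵢ + [i = j] bᵢ + [j < i] (…) bᵢ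
 - (sin(2Nᵢtᵢ)/(2Nᵢ)) ∂ⱼbᵢ)`. [folklore] -/
theorem fderiv_g_apply_eV_tang' (hH : Holonomic S) (hf : ContDiff ℝ ∞ S.f) (hA : ContDiff ℝ ∞ S.A)
    (hN : ∀ i, S.N i ≠ 0) (ha : ∀ i, S.a i ≠ 0) (i₀ : Fin S.k) (z : EuclideanSpace ℝ (Fin n)) :
    fderiv ℝ S.g z (eV (S.tang i₀)) =
      (fderiv ℝ S.f z (eV (S.tang i₀)) +
        ∑ l ∈ Finset.univ.filter (fun l : Fin n => S.IsNormal l), z l • fderiv ℝ (S.w l) z (eV (S.tang i₀))) +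
      ∑ i : Fin S.k,
        ((z S.κ - S.Θ i z) •
            ((if i = i₀ then 2 / S.a i * Real.sin (S.N i * z (S.tang i)) else 0) • S.b i z +
              (-(2 / (S.a i * S.N i)) * Real.cos (S.N i * z (S.tang i))) • fderiv ℝ (S.b i) z (eV (S.tang i₀))) +
          ((if i = i₀ then (1 : ℝ) else 0) • S.b i z +
            (if i₀ < i then 2 * (S.a i₀ * S.N i₀) / (S.a i * S.N i) *
                Real.cos (S.N i₀ * z (S.tang i₀)) * Real.cos (S.N i * z (S.tang i)) else 0) • S.b i z +
            (-(Real.sin (2 * S.N i * z (S.tang i)) / (2 * S.N i))) • fderiv ℝ (S.b i) z (eV (S.tang i₀)))) := by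
  rw [fderiv_g_apply_eV_tang hf hA hN ha i₀ z]
  congr 1
  refine Finset.sum_congr rfl fun i _ => ?_
  rw [← key_combination hH hN ha i i₀ z]
  abel

end Key

end Setup

end Literature.Topology.Immersions.HolonomicApprox
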